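import Summits.QuantumFields.YangMills.Theorems.UnitScaleTiltProp7PinnedRegaugeChartDivergenceTorus
import HarnessLib

/-!
# Prop 7 pinned re-gauge chart — the (P-bch-div) rows `hR`, `hRK` in the LETTERS OF THE (α′) KNIT ✓ `Prop7SliceOfCorrectorRows.slice_of_corrector_rows`

Route-R E′, path (α′), gap (P-bch-div) of `stmt-QuantumFields-19200` (crux `MinimiserStabilityRegPr`), cell ym3-torus, width seat px15.

THE STEP.  STEP 4 of the knit (✓p658920) consumes, for the chart remainder `R` (Hermitian letter, `i·R = R₂`), the two rows
`hR : Σ_x Σ_{jk} ‖(D*_W (i·R))(x)_{jk}‖² ≤ θ₂` and `hRK : K_W(i·R) ≤ θ₃`.  Here both are DISCHARGED with explicit θ's from the landed bricks: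
`hR` from ✓ `Prop7PinnedRegaugeChartDivergenceTorus.sum_norm_divB_chartRemainder_sq_le_torus` (HS `≤ N·`op, ✓ `Prop7CovariantCoercivity.sum_norm_sq_le_mul_opNorm_sq`),
`hRK` from the sup row of `R` (each plaquette term is a sum of four `SU(N)`-conjugates of `i·R`).

WHAT IS PROVED (def-free; any `P`, level `i`, `SU(N)`; the knit instantiates `P := F.P K`, `i := 0`, `N := 2`).
* ★★★ `divB_HS_sq_le_of_chartRemainder` — the row `hR` with
  `θ₂ := N·3d·[4(20(τ+ρ))²·Σ_b‖(D_W log u)(b)‖² + (50(σ+ρ))²·(CURL_HS(Y) + DIV_HS(Y) + 2daN·Σ_b‖Y_b‖²) + (10(σ+τ))²·(CURL_HS(δ) + DIV_HS(δ) + 2daN·Σ_b‖δ_b‖²)]`,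
  for ANY bond field `R` with `i·R_b = Φ♯(u(b.src), Y_b + 1, δ_b)` (displayed), under the sup rows `‖u − 1‖ ≤ σ`, `‖Y_b‖ ≤ τ`, `‖δ_b‖ ≤ ρ` (`≤ 1∕256`)
  and the plaquette row `dist1(W(∂p)) ≤ a`.
* ★ `plaqK_le_of_sup` — the row `hRK` with `θ₃ := |Plaq|·(4r)²` for any bond field with `‖R_b‖ ≤ r` (`W` arbitrary).
* ★ `norm_chartRemainderDiag_le` — the sup row itself: `‖Φ♯(u, E, δ)‖ ≤ 8τρ + 4στ + 6σρ` (the `r` above).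
HONEST SCOPE.  Bookkeeping over the landed bricks; the knit's three bookings (`DIV_W(D_W log u)`, `CURL_W(D_W log u)`, `DIV_W(Y) ≤ C_blk ℓ⁻²M`) and the
`Y ↔ D‴` re-lettering remain the knit's.  Constants ours; nothing of the cited papers is asserted.

References: T. Bałaban, CMP 102 (1985) 277–309 [Balaban1985Variational] ((47)–(48) pp.285–286, (135) p.298, (141)–(143) p.299); CMP 99 (1985) 389–434
[Balaban1985BackgroundPropagators] ((3.8)–(3.11) p.392).
-/

set_option autoImplicit false

noncomputable section

open scoped BigOperators Matrix.Norms.L2Operator Matrix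
open NormedSpace

namespace Summit.QuantumFields.YangMills.Theorems.Prop7PinnedRegaugeChartDivergenceHR

open Literature.MathematicalPhysics.QuantumFieldTheory.Balaban1983to89
open Finset B1RG242Torus
open MatrixLog (mlog norm_mlog_le_two_mul)
open B7Eq31BCH (eq31_of_sum_le)
open Summit.QuantumFields.YangMills.Theorems.Prop7HolRatioPerStep (norm_star_coe_eq_one)
open Summit.QuantumFields.YangMills.Theorems.Prop7PinnedRegaugeChartBCH (norm_mlog_mul_exp_neg_mlog_add_sub_le)
open Summit.QuantumFields.YangMills.Theorems.Prop7PinnedRegaugeChartLipschitz (norm_mul_le_left_of_le_one)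
open Summit.QuantumFields.YangMills.Theorems.Prop7PinnedRegaugeChartDiagonal (diag_pack chartRemainderDiag_split)
open B9Eq39Adjoint (covD curl divB)
open B10Eq27TorusAxialLog (unitsField toUField)
open B9TorusCalculus (torusT)
open Summit.QuantumFields.YangMills.Theorems.Prop7CovIterLambdaBound (norm_conj_su_le)
open Summit.QuantumFields.YangMills.Theorems.Prop7CovariantCoercivity (sum_norm_sq_le_mul_opNorm_sq)
open Summit.QuantumFields.YangMills.Theorems.Prop7PinnedRegaugeChartDivergenceTorus (sum_norm_divB_chartRemainder_sq_le_torus)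

variable {P : Params} {N : ℕ} [NeZero N] {i : ℕ}

/-- ★★★ **THE ROW `hR` OF THE (α′) KNIT, DISCHARGED.**  `W : GaugeField P i SU(N)` with `dist1(W(∂p)) ≤ a`; corrector `u : sites → SU(N)`, ratio
field `Y`, covariant-difference data `δ`, and ANY bond field `R` whose `i`-multiple is the displayed chart remainder,
`i·R_{(z,κ)} = log(u(z)·(Y_{(z,κ)} + 1)·e^{−log u(z) + δ_{(z,κ)}}) − (log(Y_{(z,κ)} + 1) + δ_{(z,κ)})`; sup rows `‖u(z) − 1‖ ≤ σ`, `‖Y_b‖ ≤ τ`, `‖δ_b‖ ≤ ρ`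
(`σ, τ, ρ ≤ 1∕256`).  Then, in the knit's letters (HS entries of the covariant divergence of `i·R`),
`Σ_x Σ_{jk} ‖(D*_W(i·R))(x)_{jk}‖² ≤ N·3d·[4(20(τ+ρ))²·Σ_b‖(D_W log u)(b)‖² + (50(σ+ρ))²·(CURL_HS(Y) + DIV_HS(Y) + 2daN·Σ_b‖Y_b‖²)
+ (10(σ+τ))²·(CURL_HS(δ) + DIV_HS(δ) + 2daN·Σ_b‖δ_b‖²)]`.
[cite: Balaban1985Variational, (135) p.298, (141)-(143) p.299] [cite: Balaban1985BackgroundPropagators, (3.8) p.392] -/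
theorem divB_HS_sq_le_of_chartRemainder (W : GaugeField P i (Matrix.specialUnitaryGroup (Fin N) ℂ)) {a : ℝ} (ha : 0 ≤ a)
    (hU : ∀ p : Plaq P i, dist1 (GaugeField.plaqHol W p) ≤ a)
    (u : Site P i → Matrix.specialUnitaryGroup (Fin N) ℂ) (Y δ R : PBond P i → Matrix (Fin N) (Fin N) ℂ) {σ τ ρ : ℝ}
    (hσ : σ ≤ 1 / 256) (hτ : τ ≤ 1 / 256) (hρ : ρ ≤ 1 / 256)
    (hu : ∀ x, ‖(u x : Matrix (Fin N) (Fin N) ℂ) - 1‖ ≤ σ) (hY : ∀ b, ‖Y b‖ ≤ τ) (hδ : ∀ b, ‖δ b‖ ≤ ρ)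
    (hR : ∀ (κ : Fin P.d) (z : Site P i), Complex.I • R ⟨z, κ⟩
        = mlog ((u z : Matrix (Fin N) (Fin N) ℂ) * (Y ⟨z, κ⟩ + 1) * exp (-mlog (u z : Matrix (Fin N) (Fin N) ℂ) + δ ⟨z, κ⟩))
          - (mlog (Y ⟨z, κ⟩ + 1) + δ ⟨z, κ⟩)) :
    (∑ x : Site P i, ∑ j : Fin N, ∑ k : Fin N,
        ‖(divB (torusT P i) (fun κ z => unitsField (toUField W) ⟨z, κ⟩) (fun κ z => Complex.I • R ⟨z, κ⟩) x) j k‖ ^ 2)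
      ≤ N * (3 * P.d * ((20 * (τ + ρ)) ^ 2 * (4 * ∑ b : PBond P i,
              ‖covD (torusT P i) (fun κ z => unitsField (toUField W) ⟨z, κ⟩) b.dir (fun z => mlog (u z : Matrix (Fin N) (Fin N) ℂ)) b.src‖ ^ 2)
          + (50 * (σ + ρ)) ^ 2 * ((∑ x : Site P i, ∑ μ : Fin P.d, ∑ ν : Fin P.d,
              (if μ < ν then ∑ j : Fin N, ∑ k : Fin N,
                ‖(curl (torusT P i) (fun κ z => unitsField (toUField W) ⟨z, κ⟩) (fun κ z => Y ⟨z, κ⟩) μ ν x) j k‖ ^ 2 else 0)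
            + ∑ x : Site P i, ∑ j : Fin N, ∑ k : Fin N,
                ‖(divB (torusT P i) (fun κ z => unitsField (toUField W) ⟨z, κ⟩) (fun κ z => Y ⟨z, κ⟩) x) j k‖ ^ 2)
            + 2 * P.d * a * (N * ∑ b : PBond P i, ‖Y b‖ ^ 2))
          + (10 * (σ + τ)) ^ 2 * ((∑ x : Site P i, ∑ μ : Fin P.d, ∑ ν : Fin P.d,
              (if μ < ν then ∑ j : Fin N, ∑ k : Fin N,
                ‖(curl (torusT P i) (fun κ z => unitsField (toUField W) ⟨z, κ⟩) (fun κ z => δ ⟨z, κ⟩) μ ν x) j k‖ ^ 2 else 0)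
            + ∑ x : Site P i, ∑ j : Fin N, ∑ k : Fin N,
                ‖(divB (torusT P i) (fun κ z => unitsField (toUField W) ⟨z, κ⟩) (fun κ z => δ ⟨z, κ⟩) x) j k‖ ^ 2)
            + 2 * P.d * a * (N * ∑ b : PBond P i, ‖δ b‖ ^ 2)))) := by
  have hfun : (fun κ z => Complex.I • R ⟨z, κ⟩)
      = (fun κ z => mlog ((u z : Matrix (Fin N) (Fin N) ℂ) * (Y ⟨z, κ⟩ + 1) * exp (-mlog (u z : Matrix (Fin N) (Fin N) ℂ) + δ ⟨z, κ⟩))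
          - (mlog (Y ⟨z, κ⟩ + 1) + δ ⟨z, κ⟩)) := funext fun κ => funext fun z => hR κ z
  rw [hfun]
  have htor := sum_norm_divB_chartRemainder_sq_le_torus W ha hU u Y δ hσ hτ hρ hu hY hδ
  refine le_trans ?_ (mul_le_mul_of_nonneg_left htor (Nat.cast_nonneg N))
  rw [Finset.mul_sum]
  exact Finset.sum_le_sum fun x _ => sum_norm_sq_le_mul_opNorm_sq _

/-- ★ **THE ROW `hRK` OF THE (α′) KNIT FROM A SUP ROW.**  For any background `W` and any bond field `R` with `‖R_b‖ ≤ r`: the door's linearised-curvature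
energy of `i·R` is at most `|Plaq|·(4r)²` (each plaquette term is a signed sum of four `SU(N)`-conjugates of `i·R`, each of norm `≤ r`).
[cite: Balaban1985Variational, (47)-(48) pp.285-286] -/
theorem plaqK_le_of_sup (W : GaugeField P i (Matrix.specialUnitaryGroup (Fin N) ℂ)) (R : PBond P i → Matrix (Fin N) (Fin N) ℂ) {r : ℝ}
    (hr : ∀ b, ‖R b‖ ≤ r) :
    (∑ p : Plaq P i, ‖((Complex.I • R ⟨p.src, p.μ⟩)
          + ((W ⟨p.src, p.μ⟩ : Matrix (Fin N) (Fin N) ℂ) * (Complex.I • R ⟨p.src.shift p.μ, p.ν⟩) * star (W ⟨p.src, p.μ⟩ : Matrix (Fin N) (Fin N) ℂ))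
          - (((W ⟨p.src, p.μ⟩ * W ⟨p.src.shift p.μ, p.ν⟩ * (W ⟨p.src.shift p.ν, p.μ⟩)⁻¹ : Matrix.specialUnitaryGroup (Fin N) ℂ) : Matrix (Fin N) (Fin N) ℂ)
              * (Complex.I • R ⟨p.src.shift p.ν, p.μ⟩)
              * star ((W ⟨p.src, p.μ⟩ * W ⟨p.src.shift p.μ, p.ν⟩ * (W ⟨p.src.shift p.ν, p.μ⟩)⁻¹ : Matrix.specialUnitaryGroup (Fin N) ℂ) : Matrix (Fin N) (Fin N) ℂ))
          - (((GaugeField.plaqHol W p : Matrix.specialUnitaryGroup (Fin N) ℂ) : Matrix (Fin N) (Fin N) ℂ) * (Complex.I • R ⟨p.src, p.ν⟩)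
              * star ((GaugeField.plaqHol W p : Matrix.specialUnitaryGroup (Fin N) ℂ) : Matrix (Fin N) (Fin N) ℂ)))‖ ^ 2)
      ≤ Fintype.card (Plaq P i) * (4 * r) ^ 2 := by
  have hI : ∀ b, ‖Complex.I • R b‖ ≤ r := fun b => by rw [norm_smul, Complex.norm_I, one_mul]; exact hr b
  have hr0 : 0 ≤ r := (norm_nonneg _).trans (hr ⟨Classical.arbitrary _, Classical.arbitrary _⟩)
  have hpt : ∀ p : Plaq P i, ‖((Complex.I • R ⟨p.src, p.μ⟩)
          + ((W ⟨p.src, p.μ⟩ : Matrix (Fin N) (Fin N) ℂ) * (Complex.I • R ⟨p.src.shift p.μ, p.ν⟩) * star (W ⟨p.src, p.μ⟩ : Matrix (Fin N) (Fin N) ℂ))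
          - (((W ⟨p.src, p.μ⟩ * W ⟨p.src.shift p.μ, p.ν⟩ * (W ⟨p.src.shift p.ν, p.μ⟩)⁻¹ : Matrix.specialUnitaryGroup (Fin N) ℂ) : Matrix (Fin N) (Fin N) ℂ)
              * (Complex.I • R ⟨p.src.shift p.ν, p.μ⟩)
              * star ((W ⟨p.src, p.μ⟩ * W ⟨p.src.shift p.μ, p.ν⟩ * (W ⟨p.src.shift p.ν, p.μ⟩)⁻¹ : Matrix.specialUnitaryGroup (Fin N) ℂ) : Matrix (Fin N) (Fin N) ℂ))
          - (((GaugeField.plaqHol W p : Matrix.specialUnitaryGroup (Fin N) ℂ) : Matrix (Fin N) (Fin N) ℂ) * (Complex.I • R ⟨p.src, p.ν⟩)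
              * star ((GaugeField.plaqHol W p : Matrix.specialUnitaryGroup (Fin N) ℂ) : Matrix (Fin N) (Fin N) ℂ)))‖ ^ 2 ≤ (4 * r) ^ 2 := by
    intro p
    have h1 := hI ⟨p.src, p.μ⟩
    have h2 : ‖(W ⟨p.src, p.μ⟩ : Matrix (Fin N) (Fin N) ℂ) * (Complex.I • R ⟨p.src.shift p.μ, p.ν⟩) * star (W ⟨p.src, p.μ⟩ : Matrix (Fin N) (Fin N) ℂ)‖ ≤ r :=
      (norm_conj_su_le _ _).trans (hI _)
    have h3 : ‖(((W ⟨p.src, p.μ⟩ * W ⟨p.src.shift p.μ, p.ν⟩ * (W ⟨p.src.shift p.ν, p.μ⟩)⁻¹ : Matrix.specialUnitaryGroup (Fin N) ℂ) : Matrix (Fin N) (Fin N) ℂ)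
              * (Complex.I • R ⟨p.src.shift p.ν, p.μ⟩)
              * star ((W ⟨p.src, p.μ⟩ * W ⟨p.src.shift p.μ, p.ν⟩ * (W ⟨p.src.shift p.ν, p.μ⟩)⁻¹ : Matrix.specialUnitaryGroup (Fin N) ℂ) : Matrix (Fin N) (Fin N) ℂ))‖ ≤ r :=
      (norm_conj_su_le _ _).trans (hI _)
    have h4 : ‖(((GaugeField.plaqHol W p : Matrix.specialUnitaryGroup (Fin N) ℂ) : Matrix (Fin N) (Fin N) ℂ) * (Complex.I • R ⟨p.src, p.ν⟩)
              * star ((GaugeField.plaqHol W p : Matrix.specialUnitaryGroup (Fin N) ℂ) : Matrix (Fin N) (Fin N) ℂ))‖ ≤ r :=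
      (norm_conj_su_le _ _).trans (hI _)
    have hs := (norm_sub_le _ _).trans (add_le_add ((norm_sub_le _ _).trans (add_le_add ((norm_add_le _ _).trans (add_le_add h1 h2)) h3)) h4)
    have h0 := norm_nonneg ((Complex.I • R ⟨p.src, p.μ⟩)
          + ((W ⟨p.src, p.μ⟩ : Matrix (Fin N) (Fin N) ℂ) * (Complex.I • R ⟨p.src.shift p.μ, p.ν⟩) * star (W ⟨p.src, p.μ⟩ : Matrix (Fin N) (Fin N) ℂ))
          - (((W ⟨p.src, p.μ⟩ * W ⟨p.src.shift p.μ, p.ν⟩ * (W ⟨p.src.shift p.ν, p.μ⟩)⁻¹ : Matrix.specialUnitaryGroup (Fin N) ℂ) : Matrix (Fin N) (Fin N) ℂ)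
              * (Complex.I • R ⟨p.src.shift p.ν, p.μ⟩)
              * star ((W ⟨p.src, p.μ⟩ * W ⟨p.src.shift p.μ, p.ν⟩ * (W ⟨p.src.shift p.ν, p.μ⟩)⁻¹ : Matrix.specialUnitaryGroup (Fin N) ℂ) : Matrix (Fin N) (Fin N) ℂ))
          - (((GaugeField.plaqHol W p : Matrix.specialUnitaryGroup (Fin N) ℂ) : Matrix (Fin N) (Fin N) ℂ) * (Complex.I • R ⟨p.src, p.ν⟩)
              * star ((GaugeField.plaqHol W p : Matrix.specialUnitaryGroup (Fin N) ℂ) : Matrix (Fin N) (Fin N) ℂ)))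
    exact pow_le_pow_left₀ h0 (hs.trans (by linarith)) 2
  calc _ ≤ ∑ _p : Plaq P i, (4 * r) ^ 2 := Finset.sum_le_sum fun p _ => hpt p
    _ = Fintype.card (Plaq P i) * (4 * r) ^ 2 := by rw [Finset.sum_const, Finset.card_univ, nsmul_eq_mul]

/-! ## The sup row of the chart remainder (the `r` of `hRK`) -/

section SupRow

variable {n : Type*} [Fintype n] [DecidableEq n] [Nonempty n]

/-- ★ **POINTWISE SIZE OF THE CHART REMAINDER IN THE CORRECTOR'S VARIABLES** (the sup row feeding `plaqK_le_of_sup`): for `‖u − 1‖ ≤ σ`,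
`‖E − 1‖ ≤ τ`, `‖δ‖ ≤ ρ` (`σ, τ, ρ ≤ 1∕256`), `‖Φ♯(u, E, δ)‖ ≤ 8τρ + 4στ + 6σρ` — bilinear in the three small letters (three-piece split
✓ `Prop7PinnedRegaugeChartDiagonal.chartRemainderDiag_split`: (31) on `r(A, L)` with `‖A‖ ≤ 2τ`, `‖L‖ ≤ 2ρ`; the Leibniz piece `≤ 4στ`; the refined (31)
✓ `Prop7PinnedRegaugeChartBCH.norm_mlog_mul_exp_neg_mlog_add_sub_le` on `Ψ`, `≤ 6σρ`). [cite: Balaban1985Averaging, (31) p.22] [cite: Balaban1985Variational, (141)-(143) p.299] -/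
theorem norm_chartRemainderDiag_le (u : Matrix.specialUnitaryGroup n ℂ) (E δ : Matrix n n ℂ) {σ τ ρ : ℝ}
    (hσ : σ ≤ 1 / 256) (hτ : τ ≤ 1 / 256) (hρ : ρ ≤ 1 / 256)
    (hu : ‖(u : Matrix n n ℂ) - 1‖ ≤ σ) (hE : ‖E - 1‖ ≤ τ) (hδ : ‖δ‖ ≤ ρ) :
    ‖mlog ((u : Matrix n n ℂ) * E * exp (-mlog (u : Matrix n n ℂ) + δ)) - (mlog E + δ)‖ ≤ 8 * τ * ρ + 4 * σ * τ + 6 * σ * ρ := by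
  have hσ0 : 0 ≤ σ := (norm_nonneg _).trans hu
  have hτ0 : 0 ≤ τ := (norm_nonneg _).trans hE
  have hρ0 : 0 ≤ ρ := (norm_nonneg _).trans hδ
  have hE1 : ‖E - 1‖ < 1 := by linarith
  have hlogE : ‖mlog E‖ ≤ 2 * τ := (norm_mlog_le_two_mul (hE.trans (by linarith))).trans (by linarith)
  obtain ⟨hX, hL, -⟩ := diag_pack u δ hσ hρ hu hδ
  rw [chartRemainderDiag_split u E δ hσ hρ hu hE1 hδ]
  -- piece 1: (31) on `r(A, L)`
  have hA : ‖(u : Matrix n n ℂ) * mlog E * star (u : Matrix n n ℂ)‖ ≤ 2 * τ := (norm_conj_su_le u _).trans hlogE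
  have t1 : ‖mlog (exp ((u : Matrix n n ℂ) * mlog E * star (u : Matrix n n ℂ)) * exp (mlog ((u : Matrix n n ℂ) * exp (-mlog (u : Matrix n n ℂ) + δ))))
        - (u : Matrix n n ℂ) * mlog E * star (u : Matrix n n ℂ) - mlog ((u : Matrix n n ℂ) * exp (-mlog (u : Matrix n n ℂ) + δ))‖ ≤ 8 * τ * ρ := by
    have h := eq31_of_sum_le (X := (u : Matrix n n ℂ) * mlog E * star (u : Matrix n n ℂ))
      (Y := mlog ((u : Matrix n n ℂ) * exp (-mlog (u : Matrix n n ℂ) + δ))) (by linarith)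
    have h2 : 2 * ‖(u : Matrix n n ℂ) * mlog E * star (u : Matrix n n ℂ)‖ * ‖mlog ((u : Matrix n n ℂ) * exp (-mlog (u : Matrix n n ℂ) + δ))‖
        ≤ 2 * (2 * τ) * (2 * ρ) := mul_le_mul (by linarith) hL (norm_nonneg _) (by positivity)
    linarith
  -- piece 2: Leibniz
  have t2 : ‖((u : Matrix n n ℂ) - 1) * mlog E * star (u : Matrix n n ℂ) + mlog E * (star (u : Matrix n n ℂ) - 1)‖ ≤ 4 * σ * τ := by
    have hs : ‖star (u : Matrix n n ℂ) - 1‖ ≤ σ := by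
      rw [← star_one, ← star_sub, norm_star]; exact hu
    have a1 : ‖((u : Matrix n n ℂ) - 1) * mlog E * star (u : Matrix n n ℂ)‖ ≤ σ * (2 * τ) :=
      (norm_mul_le_left_of_le_one (norm_star_coe_eq_one u).le).trans ((norm_mul_le _ _).trans (mul_le_mul hu hlogE (norm_nonneg _) hσ0))
    have a2 : ‖mlog E * (star (u : Matrix n n ℂ) - 1)‖ ≤ 2 * τ * σ :=
      (norm_mul_le _ _).trans (mul_le_mul hlogE hs (norm_nonneg _) (by positivity))
    have := norm_add_le (((u : Matrix n n ℂ) - 1) * mlog E * star (u : Matrix n n ℂ)) (mlog E * (star (u : Matrix n n ℂ) - 1))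
    nlinarith
  -- piece 3: the refined (31) on `Ψ`
  have t3 : ‖mlog ((u : Matrix n n ℂ) * exp (-mlog (u : Matrix n n ℂ) + δ)) - δ‖ ≤ 6 * σ * ρ := by
    have h := norm_mlog_mul_exp_neg_mlog_add_sub_le u δ (hu.trans (by linarith)) (hδ.trans (by linarith))
    have h2 : 3 * ‖mlog (u : Matrix n n ℂ)‖ * ‖δ‖ ≤ 3 * (2 * σ) * ρ := mul_le_mul (by linarith) hδ (norm_nonneg _) (by positivity)
    linarith
  have h := norm_add₃_le
    (a := mlog (exp ((u : Matrix n n ℂ) * mlog E * star (u : Matrix n n ℂ)) * exp (mlog ((u : Matrix n n ℂ) * exp (-mlog (u : Matrix n n ℂ) + δ))))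
        - (u : Matrix n n ℂ) * mlog E * star (u : Matrix n n ℂ) - mlog ((u : Matrix n n ℂ) * exp (-mlog (u : Matrix n n ℂ) + δ)))
    (b := ((u : Matrix n n ℂ) - 1) * mlog E * star (u : Matrix n n ℂ) + mlog E * (star (u : Matrix n n ℂ) - 1))
    (c := mlog ((u : Matrix n n ℂ) * exp (-mlog (u : Matrix n n ℂ) + δ)) - δ)
  linarith

end SupRow

end Summit.QuantumFields.YangMills.Theorems.Prop7PinnedRegaugeChartDivergenceHR

end
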